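import Literature.MathematicalPhysics.QuantumFieldTheory.Balaban1983to89.B6SectCTwoScaleV1

/-!
# `Balaban1983to89.B6AdmissibleProjectionV1` — T. Bałaban, *Propagators and renormalization transformations for lattice gauge
# theories. II*, Commun. Math. Phys. **96** (1984) 223–250 [Balaban1984PropagatorsII], (2.104)–(2.106) pp. 241–242: THE ORTHOGONAL PROJECTION
# ONTO THE ADMISSIBLE `ω` (*«ω defined on Λ»*, *«∫dω↾_Λ δ(Q′₁ω)»*: `ω = 0` off `B(Λ′)`, `Q′₁ω = 0` on `Λ′`) of the V1 two-scale carrier, EXPLICITLY —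
# `(Pω)(x) = 1_{y(x)∈Λ′}·(ω(x) − (Q′₁ω)(y(x)))` — and the BLOCK-LOCALITY of its kernel (the input (b) of the Combes–Thomas route to p. 242's
# «exponential decay of C^{(j)}_Λ», cf. the same seat's `…B6Cov2110CombesThomas`)

statement-level skeleton of published theorems with citation tags; proofs where landed; nothing here is a claim about the Yang–Mills mass gap

PDF held: `paper:balaban1984-cmp96-propagators-rt-ii` (journal page = PDF page + 222; pp. 241–242 [PDF 19–20] read AS IMAGES on the ×2 renders
`run/shared/lean/pub/pub-balaban/b2b-balaban-ref1/pages/1984-cmp96-propagators-rt-II/…-p019/p020-x2.png`, 2026-08-21).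

PRINT (verbatim, p. 241 (2.104) and p. 242 (2.105)–(2.106)).  *"μ = 0 on Λ^c, Q′₁μ = 0 on Λ′. (2.104)"*;  *"· ∫dω↾_Λ δ(Q′₁ω) Z′_j⁻¹ ∫dλ′δ(Q′_jλ′ − ω) …
(2.105)"*;  *"= ∫dω↾_Λ δ(Q′₁ω) e^{−½⟨ω, Δ′_jω⟩} e^{⟨ω, H′_j*Δ∂*A − H′_j*∂*J⟩} · (…)⁻¹, (2.106)"*.

CITATION HEADER (lean-in-tree rule) — WHAT IS REPRODUCED.  Phase-2 file of the `lit-balaban` typed skeleton (HOME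
`run/shared/lean/pub/lit-balaban/`), seat **p22 gen 11** (B6 fold owner r03, referee ref-4; lane = the Sect. C chain (2.95)–(2.147) on the
concrete two-scale data `tsV1`).  SKELETON rows **B6.Eq2.103** ((2.104)) / **B6.Eq2.105** / **B6.Eq2.110** (*"+ C^{(j)}_Λ"*): the carrier of the
`ω`-integration of (2.105)–(2.106) is gen 8's typed `…B6SectCTwoScaleV1.admissible P j Λ′` (`S₁` of the two-scale data; `C^{(j)}_Λ = covOp S₁ Δ′_j`).
IMPORTS BY NAME: `admissible`, `LatticeFieldCalculus.siteAvg` (`Q′₁`), p08's `BIJ85GaugeFunction5113.siteAvg_sub`, `TorusGeometry`'s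
`Site.blockEquiv`/`blockOf_blockSite`, Mathlib's `Submodule.eq_starProjection_of_mem_of_inner_eq_zero`.  THIS FILE (standing range `j + 1 ≤ m + K`):
* §1 `siteAvg_blockFun` (the block mean of a block function is the function), `sum_blockSite` bookkeeping;
* §2 **`starProjection_admissible_eq`**: the orthogonal projection of the V1 unit-lattice carrier onto the admissible `ω` is
  `(Pω)(x) = 1_{y(x)∈Λ′}(ω(x) − (Q′₁ω)(y(x)))` (restriction to `B(Λ′)`, then removal of the block means);
* §3 its KERNEL: `siteAvg_single` (`Q′₁e_{x′} = L^{−d}1_{y = y(x′)}`), **`starProjection_admissible_single`**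
  (`(Pe_{x′})(x) = 1_{y(x)∈Λ′}(δ_{xx′} − L^{−d}1_{y(x)=y(x′)})`) and **`starProjection_admissible_blockLocal`**: `(Pe_{x′})(x) ≠ 0 ⇒ y(x) ∈ Λ′ ∧ y(x) = y(x′)`.
THEOREMS ONLY (no definition, no `def … : Prop` fact); standard axioms.  HONEST SCOPE: elementary (the print never spells the projection out; it
integrates `∫dω↾_Λ δ(Q′₁ω)`, whose Gaussian covariance is the inverse of `Δ′_j` compressed to this subspace — gen 7's `covOp`); finite tori of the V1
calculus, centred blocks (`L` odd); NOT summit progress.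
-/

noncomputable section

open scoped InnerProductSpace

namespace Literature.MathematicalPhysics.QuantumFieldTheory.Balaban1983to89.B6AdmissibleProjectionV1

open LatticeFieldCalculus B6SectAOperatorsV1 B6SectCTwoScaleV1
open BalabanImbrieJaffe1984to88.BIJ85GaugeFunction5113 (siteAvg_sub)

variable {P : Params} {j : ℕ} (hj : j + 1 ≤ P.m + P.K) (Λ' : Finset (Site P (j + 1)))

/-! ## §1  Block bookkeeping -/

/-- a sum over the fine torus is the sum over blocks of the sums over block offsets (standing range). [folklore] -/
private theorem sum_blockSite {α : Type*} [AddCommMonoid α] (hj : j + 1 ≤ P.m + P.K) (F : Site P j → α) :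
    ∑ x, F x = ∑ y : Site P (j + 1), ∑ r : Fin P.d → Fin P.L, F (Site.blockSite y r) := by
  rw [← Finset.sum_fiberwise_of_maps_to (s := Finset.univ) (t := Finset.univ) (g := blockOf) (fun _ _ => Finset.mem_univ _) F]
  refine Finset.sum_congr rfl fun y _ => ?_
  have hmem : ∀ x : Site P j, blockOf x = y ↔ x ∈ ({x ∈ Finset.univ | blockOf x = y} : Finset (Site P j)) := fun x => by simp
  let e : (Fin P.d → Fin P.L) ≃ ↥({x ∈ Finset.univ | blockOf x = y} : Finset (Site P j)) :=
    (Site.blockEquiv hj y).symm.trans (Equiv.subtypeEquivRight hmem)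
  rw [← Finset.sum_coe_sort _ F, ← Equiv.sum_comp e (fun a => F a.1)]
  exact Finset.sum_congr rfl fun r _ => rfl

/-- the sum over the fibre `{x : y(x) = y}` is the sum over the block offsets. [folklore] -/
private theorem sum_fiber_eq (hj : j + 1 ≤ P.m + P.K) (y : Site P (j + 1)) (F : Site P j → ℝ) :
    ∑ x ∈ Finset.univ.filter (fun x : Site P j => blockOf x = y), F x = ∑ r : Fin P.d → Fin P.L, F (Site.blockSite y r) := by
  have hmem : ∀ x : Site P j, blockOf x = y ↔ x ∈ ({x ∈ Finset.univ | blockOf x = y} : Finset (Site P j)) := fun x => by simp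
  let e : (Fin P.d → Fin P.L) ≃ ↥({x ∈ Finset.univ | blockOf x = y} : Finset (Site P j)) :=
    (Site.blockEquiv hj y).symm.trans (Equiv.subtypeEquivRight hmem)
  rw [← Finset.sum_coe_sort _ F, ← Equiv.sum_comp e (fun a => F a.1)]
  exact Finset.sum_congr rfl fun r _ => rfl

/-- the number of block offsets is `L^d`. [folklore] -/
private theorem card_offsets : (Fintype.card (Fin P.d → Fin P.L) : ℝ) = (P.L : ℝ) ^ P.d := by
  rw [Fintype.card_fun, Fintype.card_fin, Fintype.card_fin]
  push_cast
  rfl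

include hj in
/-- **the block mean of a block function is the function**: `Q′₁(g ∘ y) = g`. [cite: Balaban1984PropagatorsII, (2.104) p.241] -/
theorem siteAvg_blockFun (g : Site P (j + 1) → ℝ) (Y : Site P (j + 1)) : siteAvg (fun x : Site P j => g (blockOf x)) Y = g Y := by
  have hL : (P.L : ℝ) ^ P.d ≠ 0 := pow_ne_zero _ P.cast_L_pos.ne'
  simp only [siteAvg, Site.blockOf_blockSite hj, Finset.sum_const, Finset.card_univ, smul_eq_mul, nsmul_eq_mul, card_offsets]
  field_simp

/-! ## §2  The orthogonal projection onto the admissible `ω`, explicitly -/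

include hj in
/-- **THE PROJECTION ONTO THE ADMISSIBLE `ω`**: for the V1 two-scale carrier, the orthogonal projection onto `admissible P j Λ′` (`ω = 0` off
`B(Λ′)`, `Q′₁ω = 0` on `Λ′`) is `(Pω)(x) = 1_{y(x)∈Λ′}·(ω(x) − (Q′₁ω)(y(x)))`: restrict to `B(Λ′)`, then subtract the block means (the block means
are orthogonal to the mean-zero fields block by block). [cite: Balaban1984PropagatorsII, (2.104)–(2.106) pp.241–242] -/
theorem starProjection_admissible_eq (ω : USite P j) :
    (admissible P j Λ').starProjection ω =
      WithLp.toLp 2 (fun x => if blockOf x ∈ Λ' then ω x - siteAvg (WithLp.ofLp ω) (blockOf x) else 0) := by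
  apply Submodule.eq_starProjection_of_mem_of_inner_eq_zero
  · refine ⟨fun y hy => ?_, fun Y hY => ?_⟩
    · show (if blockOf y ∈ Λ' then ω y - siteAvg (WithLp.ofLp ω) (blockOf y) else 0) = 0
      rw [if_neg hy]
    · rw [WithLp.ofLp_toLp]
      have h1 : (fun x => if blockOf x ∈ Λ' then ω x - siteAvg (WithLp.ofLp ω) (blockOf x) else 0) =
          (fun x => (if blockOf x ∈ Λ' then ω x else 0)) - (fun x => if blockOf x ∈ Λ' then siteAvg (WithLp.ofLp ω) (blockOf x) else 0) := by
        funext x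
        simp only [Pi.sub_apply]
        split_ifs <;> simp
      rw [h1, siteAvg_sub, Pi.sub_apply,
        siteAvg_blockFun hj (fun Y => if Y ∈ Λ' then siteAvg (WithLp.ofLp ω) Y else 0) Y, if_pos hY]
      simp only [siteAvg, Site.blockOf_blockSite hj, if_pos hY, smul_eq_mul]
      exact sub_self _
  · intro w hw
    rw [inner_eq_sum, sum_blockSite hj]
    refine Finset.sum_eq_zero fun Y _ => ?_
    by_cases hY : Y ∈ Λ'
    · have hterm : ∀ r : Fin P.d → Fin P.L,
          (ω - WithLp.toLp 2 (fun x => if blockOf x ∈ Λ' then ω x - siteAvg (WithLp.ofLp ω) (blockOf x) else 0)) (Site.blockSite Y r) *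
            w (Site.blockSite Y r) = siteAvg (WithLp.ofLp ω) Y * w (Site.blockSite Y r) := by
        intro r
        simp only [PiLp.sub_apply]
        rw [Site.blockOf_blockSite hj, if_pos hY]
        ring
      simp only [hterm, ← Finset.mul_sum]
      have hsum : ∑ r : Fin P.d → Fin P.L, w (Site.blockSite Y r) = (P.L : ℝ) ^ P.d * siteAvg (WithLp.ofLp w) Y := by
        simp only [siteAvg, smul_eq_mul]
        rw [← mul_assoc, mul_inv_cancel₀ (pow_ne_zero _ P.cast_L_pos.ne'), one_mul]
      rw [hsum, hw.2 Y hY, mul_zero, mul_zero]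
    · refine Finset.sum_eq_zero fun r _ => ?_
      have hw0 : w (Site.blockSite Y r) = 0 := hw.1 _ (by rwa [Site.blockOf_blockSite hj])
      rw [hw0, mul_zero]

include hj in
/-- the projection pointwise. [cite: Balaban1984PropagatorsII, (2.104)–(2.106) pp.241–242] -/
theorem starProjection_admissible_apply (ω : USite P j) (x : Site P j) :
    (admissible P j Λ').starProjection ω x = if blockOf x ∈ Λ' then ω x - siteAvg (WithLp.ofLp ω) (blockOf x) else 0 := by
  rw [starProjection_admissible_eq hj Λ' ω, PiLp.toLp_apply]

/-! ## §3  The kernel of the projection and its block-locality -/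

include hj in
/-- `Q′₁e_{x′} = L^{−d}·1_{Y = y(x′)}`: the block mean of a unit vector. [cite: Balaban1984PropagatorsII, (2.104) p.241] -/
theorem siteAvg_single (x' : Site P j) (Y : Site P (j + 1)) :
    siteAvg (WithLp.ofLp (EuclideanSpace.single x' (1 : ℝ))) Y = if Y = blockOf x' then ((P.L : ℝ) ^ P.d)⁻¹ else 0 := by
  simp only [siteAvg, PiLp.ofLp_single, smul_eq_mul]
  rw [← sum_fiber_eq hj Y (Pi.single x' (1 : ℝ))]
  by_cases hY : Y = blockOf x'
  · rw [if_pos hY, Finset.sum_eq_single x' (fun x _ hx => Pi.single_eq_of_ne hx 1)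
      (fun hx => (hx (Finset.mem_filter.mpr ⟨Finset.mem_univ x', hY.symm⟩)).elim), Pi.single_eq_same, mul_one]
  · rw [if_neg hY, Finset.sum_eq_zero fun x hx => ?_, mul_zero]
    have hx' : x ≠ x' := fun h => hY (by rw [← (Finset.mem_filter.mp hx).2, h])
    exact Pi.single_eq_of_ne hx' 1

include hj in
/-- **THE KERNEL OF THE PROJECTION**: `(Pe_{x′})(x) = 1_{y(x)∈Λ′}·(δ_{xx′} − L^{−d}·1_{y(x) = y(x′)})`.
[cite: Balaban1984PropagatorsII, (2.104)–(2.106) pp.241–242] -/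
theorem starProjection_admissible_single (x' x : Site P j) :
    (admissible P j Λ').starProjection (EuclideanSpace.single x' (1 : ℝ)) x =
      if blockOf x ∈ Λ' then (if x = x' then (1 : ℝ) else 0) - (if blockOf x = blockOf x' then ((P.L : ℝ) ^ P.d)⁻¹ else 0) else 0 := by
  rw [starProjection_admissible_apply hj Λ', siteAvg_single hj, PiLp.single_apply]

include hj in
/-- **BLOCK-LOCALITY of the projection's kernel**: `(Pe_{x′})(x) ≠ 0` only if `y(x) ∈ Λ′` and `x, x′` lie in the same block.
[cite: Balaban1984PropagatorsII, (2.104)–(2.106) pp.241–242] -/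
theorem starProjection_admissible_blockLocal {x' x : Site P j}
    (h : (admissible P j Λ').starProjection (EuclideanSpace.single x' (1 : ℝ)) x ≠ 0) : blockOf x ∈ Λ' ∧ blockOf x = blockOf x' := by
  rw [starProjection_admissible_single hj Λ'] at h
  by_cases h1 : blockOf x ∈ Λ'
  · refine ⟨h1, ?_⟩
    by_contra h2
    have h3 : x ≠ x' := fun h4 => h2 (by rw [h4])
    rw [if_pos h1, if_neg h3, if_neg h2, sub_zero] at h
    exact h rfl
  · rw [if_neg h1] at h
    exact absurd rfl h

end Literature.MathematicalPhysics.QuantumFieldTheory.Balaban1983to89.B6AdmissibleProjectionV1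

end
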